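import Summits.BirchSwinnertonDyer.BirchSwinnertonDyer.Theorems.ThetaPartnerAtTwoMazurTateCongruenceAtTwoRIntegrality
import Summits.BirchSwinnertonDyer.BirchSwinnertonDyer.Theorems.ResidualThetaTransportAtTwoResidualThetaMainConjectureAtTwoAnalyticLayerLawAtTwo
import HarnessLib

/-!
# Crux `MazurTateCongruenceAtTwoR` (stmt-BirchSwinnertonDyer-21416 = 25797 `MazurTateCongruenceAtTwoTop` BY NAME;
# stub `stub_V2mtR` of K1 20333, line `bridge`) — route-independent core, part 2:
# layer congruences ⟹ the Λ-congruence, and the period-unit reduction to the `Ω⁺`-normalised congruence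

Cell `bsd-wall`, seat `bsd-wall-tp2-p1-w2` (WIDTH seat on the K1 row). THEOREMS ONLY (no `def`, no named fact, no
`sorry`); no route file is imported (the class-level corollaries that name the Theses decl live in the leaf file
`…MazurTateCongruenceAtTwoRNormalForm`).

§ Core (any prime `p`; Greenberg–Vatsal 2000 §3, "congruent Mazur–Tate elements at all layers ⟹ congruent `p`-adic
`L`-functions", in the SIGNED setting where the layer element is `ω_n^∓ · L^∓ (mod ω_n)`): let `Z ∈ Λ = ℤ_p⟦T⟧` and suppose
that for layers `n` with `pⁿ − d_n` UNBOUNDED there are `ω⁽ⁿ⁾ ∈ ℤ[X]`, `ω⁽ⁿ⁾ ≡ u_n X^{d_n} (mod p)`, `u_n ≠ 0`, with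
`ω⁽ⁿ⁾ · Z ∈ (p^k, ω_n)Λ`. Then `p^k ∣ Z` (`C_pow_dvd_of_layer_congruences`): modulo `p`, `u_n X^{d_n} Z̄ ∈ (X^{pⁿ})`
forces `X^{pⁿ − d_n} ∣ Z̄`, so `Z̄ = 0`; induct on `k` with `ω_n r ∈ p^k Λ ⟹ r ∈ p^k Λ`
(`C_pow_dvd_of_cyclotomicOmega_mul_eq`; `ω_n ≡ X^{pⁿ}` is a non-zero-divisor mod `p`).

§ Two (`p = 2`, even `n = 2j`, `ω⁽ⁿ⁾ = (−1)^{j+1} ω_n^-`, `d_n = (2ⁿ − 1)/3`, `map_signedOmegaMinus_two_zmod`): with the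
integrality transfer `exists_coe_eq_C_mul_of_isCongrModOmega` the layer identities of the crux for a unit `u` are exactly
`ω⁽ⁿ⁾ · Z ∈ (2^{m+m'+1}, ω_n)Λ`, `Z = 2^{m'} G E − u 2^m G_A E_A`; hence (`lambda_congruence_two_of_layer_congruences`,
POINTWISE in the data `f, f_A`, Pollack pairs, `G, G_A, E, E_A, u`) they force (GV2Λ) `Z ∈ 2^{m+m'+1} Λ` — the converse
of `layer_congruence_two_of_lambda_congruence` (file `…OfLambda`).

§ Period (`p` any / `2`): if the period ratio has `|ϖ|_p = 1` then an integral multiple `ι G = p^m ϖ ι L` IS `p^m·(ϖ̃ L)` in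
`Λ` with `ϖ̃ ∈ ℤ_pˣ` (`exists_eq_C_pow_mul_C_mul_of_norm_eq_one`); consequently, for unit period ratios, (GV2Λ) for all
integral multiples is EQUIVALENT to the PERIOD-FREE congruence (V2♭) `L♭ E − u' L♭_A E_A ∈ 2Λ` of the `Ω⁺`-normalised
signed functions (`lambda_congruence_two_of_flat_congruence`, `flat_congruence_two_of_lambda_congruence`). On the habitat
`|ϖ|₂ = 1` is the printed Greenberg–Vatsal Rem. (3.4) at `2` (tree fact `realPeriodRat_eq_unit_mul_plusPeriod_two`,
Abbes–Ullmo), applied in the leaf file.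

References: R. Greenberg, V. Vatsal, Invent. Math. 142 (2000) §3, (13), Remark (3.4) [GreenbergVatsal2000]; R. Pollack,
Duke Math. J. 118 (2003) Prop. 6.18 [Pollack2003]; L. Washington, GTM 83, §7.1 [Washington1997].
-/

set_option linter.dupNamespace false
set_option autoImplicit false

noncomputable section

open scoped Classical MatrixGroups ModularForm

open CongruenceSubgroup Polynomial WeierstrassCurve NumberField IsDedekindDomain
  Literature.NumberTheory.EllipticCurves Literature.NumberTheory.EllipticCurves.ModularForms
  Literature.NumberTheory.EllipticCurves.Rank1Residual Literature.NumberTheory.EllipticCurves.GreenbergVatsal2000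
  Literature.NumberTheory.EllipticCurves.Sprung2017
  Summit.BirchSwinnertonDyer.Rank1Residual.X1.MuLambda Summit.BirchSwinnertonDyer.Rank1Residual.Supersingular
  Summit.BirchSwinnertonDyer.Rank1Residual.X2.GreenbergVatsalAnalyticTransferCore
  Summit.BirchSwinnertonDyer.BirchSwinnertonDyer.Theorems.ResidualThetaLayer

namespace Summit.BirchSwinnertonDyer.BirchSwinnertonDyer.Theorems.MazurTateCongruenceAtTwoR

section Core

variable {p : ℕ} [hp : Fact p.Prime]

/-- `g mod p = 0 ⟹ p ∣ g` in `Λ` (reduction by `toZMod`). [cite: Washington1997, §7.1] -/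
theorem C_dvd_of_map_toZMod_eq_zero {g : IwasawaAlgebra p}
    (h : PowerSeries.map (PadicInt.toZMod (p := p)) g = 0) : PowerSeries.C (p : ℤ_[p]) ∣ g := by
  rw [← red_eq_zero_iff]
  by_contra hred
  exact map_toZMod_ne_zero_of_red_ne_zero hred h

/-- **`ω_n` is a non-zero-divisor modulo `p^k`**: `ω_n · r ∈ p^k Λ ⟹ r ∈ p^k Λ` (`ω_n ≡ X^{pⁿ} (mod p)` and
`𝔽_p⟦X⟧` is a domain). [cite: Washington1997, §7.1] -/
theorem C_pow_dvd_of_cyclotomicOmega_mul_eq {n : ℕ} :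
    ∀ (k : ℕ) {r y : IwasawaAlgebra p},
      (((cyclotomicOmega p n).map (Int.castRingHom ℤ_[p]) : ℤ_[p][X]) : PowerSeries ℤ_[p]) * r =
        PowerSeries.C ((p : ℤ_[p]) ^ k) * y →
      PowerSeries.C ((p : ℤ_[p]) ^ k) ∣ r := by
  intro k
  induction k with
  | zero => intro r y _; exact ⟨r, by rw [pow_zero, map_one, one_mul]⟩
  | succ k ih =>
    intro r y h
    obtain ⟨r₁, hr₁⟩ := ih (y := PowerSeries.C (p : ℤ_[p]) * y) (by rw [h, pow_succ, map_mul, mul_assoc])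
    have h1 : (((cyclotomicOmega p n).map (Int.castRingHom ℤ_[p]) : ℤ_[p][X]) : PowerSeries ℤ_[p]) * r₁ =
        PowerSeries.C (p : ℤ_[p]) * y := by
      apply mul_left_cancel₀ (C_pow_ne_zero (p := p) k)
      rw [← mul_assoc, mul_comm (PowerSeries.C _) (((cyclotomicOmega p n).map _ : ℤ_[p][X]) : PowerSeries ℤ_[p]),
        mul_assoc, ← hr₁, h, pow_succ, map_mul, mul_assoc]
    have hCp : PowerSeries.map (PadicInt.toZMod (p := p)) (PowerSeries.C (p : ℤ_[p])) = 0 := by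
      have h := map_toZMod_C_p_pow_succ (p := p) 0
      rwa [zero_add, pow_one] at h
    have h2 : PowerSeries.map (PadicInt.toZMod (p := p)) r₁ = 0 := by
      have h3 := congr_arg (PowerSeries.map (PadicInt.toZMod (p := p))) h1
      rw [map_mul, map_mul, map_toZMod_cyclotomicOmega, hCp, zero_mul, mul_eq_zero] at h3
      exact h3.resolve_left (pow_ne_zero _ PowerSeries.X_ne_zero)
    obtain ⟨r₂, hr₂⟩ := C_dvd_of_map_toZMod_eq_zero h2
    exact ⟨r₂, by rw [hr₁, hr₂, pow_succ, map_mul, mul_assoc]⟩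

/-- **Layer congruences at unboundedly many layers force a congruence in `Λ`.** Let `Z ∈ Λ`, `k ∈ ℕ`. Suppose that
for every `N` there are a layer `n`, a shift `d` with `N + d ≤ pⁿ`, a polynomial `ω ∈ ℤ[X]` with `ω ≡ u X^d (mod p)`,
`u ≠ 0`, and `q, r ∈ Λ` with `ω · Z = p^k q + ω_n r`. Then `p^k ∣ Z` in `Λ`. (Greenberg–Vatsal's passage from all
layers to `Λ`, with the signed distinguished factors `ω = ±ω_n^∓`.) [cite: GreenbergVatsal2000, §3, (13)]
[cite: Washington1997, §7.1] -/
theorem C_pow_dvd_of_layer_congruences :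
    ∀ (k : ℕ) {Z : IwasawaAlgebra p},
      (∀ N : ℕ, ∃ (n d : ℕ) (ω : ℤ[X]) (u : ZMod p) (q r : IwasawaAlgebra p), N + d ≤ p ^ n ∧ u ≠ 0 ∧
        ω.map (Int.castRingHom (ZMod p)) = C u * X ^ d ∧
        ((ω.map (Int.castRingHom ℤ_[p]) : ℤ_[p][X]) : PowerSeries ℤ_[p]) * Z =
          PowerSeries.C ((p : ℤ_[p]) ^ k) * q +
            (((cyclotomicOmega p n).map (Int.castRingHom ℤ_[p]) : ℤ_[p][X]) : PowerSeries ℤ_[p]) * r) →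
      PowerSeries.C ((p : ℤ_[p]) ^ k) ∣ Z := by
  intro k
  induction k with
  | zero => intro Z _; exact ⟨Z, by rw [pow_zero, map_one, one_mul]⟩
  | succ k ih =>
    intro Z h
    -- induction hypothesis: `Z = p^k Z₁`
    obtain ⟨Z₁, hZ₁⟩ := ih (Z := Z) fun N ↦ by
      obtain ⟨n, d, ω, u, q, r, hN, hu, hω, hZ⟩ := h N
      exact ⟨n, d, ω, u, PowerSeries.C (p : ℤ_[p]) * q, r, hN, hu, hω, by rw [hZ, pow_succ, map_mul, mul_assoc]⟩
    -- `Z₁ ≡ 0 (mod p)`: all its coefficients vanish mod `p`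
    suffices hbar : PowerSeries.map (PadicInt.toZMod (p := p)) Z₁ = 0 by
      obtain ⟨Z₂, hZ₂⟩ := C_dvd_of_map_toZMod_eq_zero hbar
      exact ⟨Z₂, by rw [hZ₁, hZ₂, pow_succ, map_mul, mul_assoc]⟩
    ext i
    rw [map_zero]
    obtain ⟨n, d, ω, u, q, r, hN, hu, hω, hZ⟩ := h (i + 1)
    set ωΛ : IwasawaAlgebra p := ((ω.map (Int.castRingHom ℤ_[p]) : ℤ_[p][X]) : PowerSeries ℤ_[p]) with hωΛ
    set ωn : IwasawaAlgebra p :=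
      (((cyclotomicOmega p n).map (Int.castRingHom ℤ_[p]) : ℤ_[p][X]) : PowerSeries ℤ_[p]) with hωn
    -- `p^k (ω Z₁ − p q) = ω_n r`, so `r = p^k r₁` and `ω Z₁ − p q = ω_n r₁`
    have h1 : ωn * r = PowerSeries.C ((p : ℤ_[p]) ^ k) * (ωΛ * Z₁ - PowerSeries.C (p : ℤ_[p]) * q) := by
      have e : (PowerSeries.C ((p : ℤ_[p]) ^ (k + 1)) : IwasawaAlgebra p) =
          PowerSeries.C ((p : ℤ_[p]) ^ k) * PowerSeries.C (p : ℤ_[p]) := by rw [pow_succ, map_mul]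
      rw [e, hZ₁] at hZ
      linear_combination -hZ
    obtain ⟨r₁, hr₁⟩ := C_pow_dvd_of_cyclotomicOmega_mul_eq k h1
    have h2 : ωΛ * Z₁ - PowerSeries.C (p : ℤ_[p]) * q = ωn * r₁ := by
      apply mul_left_cancel₀ (C_pow_ne_zero (p := p) k)
      rw [← h1, hr₁, ← mul_assoc, mul_comm ωn, mul_assoc]
    -- reduce mod `p`: `u X^d Z̄₁ = X^{pⁿ} r̄₁`
    have hbarω : PowerSeries.map (PadicInt.toZMod (p := p)) ωΛ = PowerSeries.C u * PowerSeries.X ^ d := by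
      rw [hωΛ, map_coe_polynomial, Polynomial.map_map,
        RingHom.ext_int ((PadicInt.toZMod (p := p)).comp (Int.castRingHom ℤ_[p])) (Int.castRingHom (ZMod p)),
        hω, Polynomial.coe_mul, Polynomial.coe_C, Polynomial.coe_pow, Polynomial.coe_X]
    have hCp : PowerSeries.map (PadicInt.toZMod (p := p)) (PowerSeries.C (p : ℤ_[p])) = 0 := by
      have h := map_toZMod_C_p_pow_succ (p := p) 0
      rwa [zero_add, pow_one] at h
    have h3 := congr_arg (PowerSeries.map (PadicInt.toZMod (p := p))) h2
    rw [map_sub, map_mul, map_mul, hbarω, hCp, zero_mul, sub_zero, map_mul, map_toZMod_cyclotomicOmega]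
      at h3
    -- cancel `X^d` and the unit `u`
    have hd : d ≤ p ^ n := le_trans (Nat.le_add_left d (i + 1)) hN
    have h4 : PowerSeries.map (PadicInt.toZMod (p := p)) Z₁ =
        PowerSeries.C u⁻¹ * PowerSeries.X ^ (p ^ n - d) * PowerSeries.map (PadicInt.toZMod (p := p)) r₁ := by
      have h5 : PowerSeries.X ^ d * (PowerSeries.C u * PowerSeries.map (PadicInt.toZMod (p := p)) Z₁) =
          PowerSeries.X ^ d * (PowerSeries.X ^ (p ^ n - d) * PowerSeries.map (PadicInt.toZMod (p := p)) r₁) :=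
        calc PowerSeries.X ^ d * (PowerSeries.C u * PowerSeries.map (PadicInt.toZMod (p := p)) Z₁)
            = PowerSeries.C u * PowerSeries.X ^ d * PowerSeries.map (PadicInt.toZMod (p := p)) Z₁ := by ring
          _ = PowerSeries.X ^ p ^ n * PowerSeries.map (PadicInt.toZMod (p := p)) r₁ := h3
          _ = PowerSeries.X ^ d * (PowerSeries.X ^ (p ^ n - d) * PowerSeries.map (PadicInt.toZMod (p := p)) r₁) := by
              rw [← mul_assoc, ← pow_add, Nat.add_sub_cancel' hd]
      have h6 := mul_left_cancel₀ (pow_ne_zero d PowerSeries.X_ne_zero) h5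
      calc PowerSeries.map (PadicInt.toZMod (p := p)) Z₁
          = PowerSeries.C u⁻¹ * (PowerSeries.C u * PowerSeries.map (PadicInt.toZMod (p := p)) Z₁) := by
            rw [← mul_assoc, ← map_mul, inv_mul_cancel₀ hu, map_one, one_mul]
        _ = _ := by rw [h6]; ring
    -- so `X^{i+1} ∣ Z̄₁`, and the `i`-th coefficient vanishes
    have hdvd : PowerSeries.X ^ (i + 1) ∣ PowerSeries.map (PadicInt.toZMod (p := p)) Z₁ := by
      rw [h4]
      exact Dvd.dvd.mul_right (Dvd.dvd.mul_left (pow_dvd_pow PowerSeries.X (by omega)) _) _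
    rw [PowerSeries.X_pow_dvd_iff] at hdvd
    exact hdvd i (Nat.lt_succ_self i)

end Core

section Two

/-- `(−1)^{n/2+1} ω_n^- ≡ (−1)^{n/2+1} X^{(2ⁿ−1)/3} (mod 2)` at an even layer `n = 2j`. [cite: Pollack2003, §6.5 (display before Prop. 6.18)] -/
theorem map_signedOmegaMinus_two_zmod (j : ℕ) :
    ((-1) ^ ((2 * j) / 2 + 1) * cyclotomicOmegaMinus 2 (2 * j)).map (Int.castRingHom (ZMod 2)) =
      C ((-1 : ZMod 2) ^ ((2 * j) / 2 + 1)) * X ^ ((2 ^ (2 * j) - 1) / 3) := by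
  have hj2 : (2 * j + 1) / 2 = j := by omega
  rw [Polynomial.map_mul, Polynomial.map_pow, Polynomial.map_neg, Polynomial.map_one, map_cyclotomicOmegaMinus_zmod,
    hj2, sum_two_pow_layer, map_pow, map_neg, C_1]

/-- **Pointwise: the layer congruences of the crux ⟹ (GV2Λ).** For two weight-`2` cusp forms `f, f_A` (any levels)
with Pollack pairs at `2`, integral multiples `ι G = 2^m ϖ ι L♭`, `ι G_A = 2^{m'} ϖ_A ι L♭_A`, factors `E, E_A ∈ Λ` and a
unit `u`: if at EVERY even layer `n` the body of `MazurTateCongruenceAtTwoR` holds at `(u, n)`, then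
`2^{m'} G E − u 2^m G_A E_A ∈ 2^{m+m'+1} Λ`. [cite: GreenbergVatsal2000, §3, (13)] [cite: Pollack2003, Prop. 6.18] -/
theorem lambda_congruence_two_of_layer_congruences {N NA : ℕ} (f : CuspForm (Gamma0 N) 2)
    (fA : CuspForm (Gamma0 NA) 2) {Lplus Lminus LplusA LminusA : IwasawaAlgebra 2}
    (hPP : IsPollackPair f 2 Lplus Lminus) (hPPA : IsPollackPair fA 2 LplusA LminusA)
    {ϖ ϖA : ℚ} {G GA E EA : IwasawaAlgebra 2} {m m' : ℕ}
    (hG : iwasawaToPowerSeries 2 G =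
      PowerSeries.C ((2 : ℚ_[2]) ^ m * (ϖ : ℚ_[2])) * iwasawaToPowerSeries 2 (kobayashiL 1 Lplus Lminus))
    (hGA : iwasawaToPowerSeries 2 GA =
      PowerSeries.C ((2 : ℚ_[2]) ^ m' * (ϖA : ℚ_[2])) * iwasawaToPowerSeries 2 (kobayashiL 1 LplusA LminusA))
    {u : ℤ_[2]ˣ}
    (hMT : ∀ n : ℕ, Even n → ∃ q r : IwasawaAlgebra 2,
      PowerSeries.C (((2 : ℤ_[2]) ^ m' : ℤ_[2]) : ℚ_[2]) *
          (PowerSeries.C ((2 : ℚ_[2]) ^ m * (ϖ : ℚ_[2])) *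
            ((mazurTateElement f 2 n).map (algebraMap ℚ ℚ_[2]) : PowerSeries ℚ_[2]) *
            iwasawaToPowerSeries 2 E) -
        PowerSeries.C (((u : ℤ_[2]) * (2 : ℤ_[2]) ^ m : ℤ_[2]) : ℚ_[2]) *
          (PowerSeries.C ((2 : ℚ_[2]) ^ m' * (ϖA : ℚ_[2])) *
            ((mazurTateElement fA 2 n).map (algebraMap ℚ ℚ_[2]) : PowerSeries ℚ_[2]) *
            iwasawaToPowerSeries 2 EA) =
      iwasawaToPowerSeries 2
        (PowerSeries.C ((2 : ℤ_[2]) ^ (m + m' + 1)) * q + toIwasawa 2 (cyclotomicOmega 2 n) * r)) :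
    ∃ q₀ : IwasawaAlgebra 2,
      PowerSeries.C ((2 : ℤ_[2]) ^ m') * G * E - PowerSeries.C ((u : ℤ_[2]) * (2 : ℤ_[2]) ^ m) * GA * EA =
        PowerSeries.C ((2 : ℤ_[2]) ^ (m + m' + 1)) * q₀ := by
  have hK : kobayashiL (1 : ℤˣ) Lplus Lminus = Lminus := if_pos rfl
  have hKA : kobayashiL (1 : ℤˣ) LplusA LminusA = LminusA := if_pos rfl
  rw [hK] at hG
  rw [hKA] at hGA
  set Z : IwasawaAlgebra 2 :=
    PowerSeries.C ((2 : ℤ_[2]) ^ m') * G * E - PowerSeries.C ((u : ℤ_[2]) * (2 : ℤ_[2]) ^ m) * GA * EA with hZ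
  obtain ⟨q₀, hq₀⟩ := C_pow_dvd_of_layer_congruences (p := 2) (m + m' + 1) (Z := Z) fun M ↦ by
    -- the even layer `n = 2M + 2` has room `M + (2ⁿ−1)/3 ≤ 2ⁿ`
    have hn : Even (2 * (M + 1)) := ⟨M + 1, two_mul _⟩
    obtain ⟨q, r, hqr⟩ := hMT (2 * (M + 1)) hn
    obtain ⟨R, ρ, -, hR, hRρ⟩ :=
      exists_coe_eq_C_mul_of_isCongrModOmega (hPP.2.2.2 _ hn) (natDegree_mazurTateElement_lt f 2 _) hG
    obtain ⟨R', ρ', -, hR', hRρ'⟩ :=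
      exists_coe_eq_C_mul_of_isCongrModOmega (hPPA.2.2.2 _ hn) (natDegree_mazurTateElement_lt fA 2 _) hGA
    rw [hR, hR'] at hqr
    set ι := iwasawaToPowerSeries 2 with hι
    have hCa : PowerSeries.C (((2 : ℤ_[2]) ^ m' : ℤ_[2]) : ℚ_[2]) = ι (PowerSeries.C ((2 : ℤ_[2]) ^ m')) := by
      rw [hι, iwasawaToPowerSeries, PowerSeries.map_C]; rfl
    have hCb : PowerSeries.C (((u : ℤ_[2]) * (2 : ℤ_[2]) ^ m : ℤ_[2]) : ℚ_[2]) =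
        ι (PowerSeries.C ((u : ℤ_[2]) * (2 : ℤ_[2]) ^ m)) := by
      rw [hι, iwasawaToPowerSeries, PowerSeries.map_C]; rfl
    rw [hCa, hCb] at hqr
    simp only [← map_mul, ← map_sub] at hqr
    have hΛ := iwasawaToPowerSeries_injective 2 hqr
    rw [hRρ, hRρ', show toIwasawa 2 (cyclotomicOmega 2 (2 * (M + 1))) =
      (((cyclotomicOmega 2 (2 * (M + 1))).map (Int.castRingHom ℤ_[2]) : ℤ_[2][X]) : PowerSeries ℤ_[2]) from rfl] at hΛ
    refine ⟨2 * (M + 1), (2 ^ (2 * (M + 1)) - 1) / 3, (-1) ^ ((2 * (M + 1)) / 2 + 1) * cyclotomicOmegaMinus 2 (2 * (M + 1)),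
      (-1 : ZMod 2) ^ ((2 * (M + 1)) / 2 + 1), q,
      r - (PowerSeries.C ((2 : ℤ_[2]) ^ m') * ρ * E - PowerSeries.C ((u : ℤ_[2]) * (2 : ℤ_[2]) ^ m) * ρ' * EA),
      ?_, pow_ne_zero _ (neg_ne_zero.mpr one_ne_zero), map_signedOmegaMinus_two_zmod (M + 1), ?_⟩
    · have h := layer_room (n := 2 * (M + 1)) (B := M) (by omega)
      omega
    · rw [hZ]
      linear_combination hΛ
  exact ⟨q₀, hq₀⟩

end Two

section Period

variable {p : ℕ} [hp : Fact p.Prime]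

/-- **An integral multiple by a `p`-adic unit scalar lives in `Λ` already**: if `ι G = C(p^m · c) · ι L` with `‖c‖_p = 1`,
then `G = p^m · (C c̃ · L)` in `Λ` for the unit `c̃ = c ∈ ℤ_pˣ`. [folklore] -/
theorem exists_eq_C_pow_mul_C_mul_of_norm_eq_one {G L : IwasawaAlgebra p} {c : ℚ_[p]} {m : ℕ} (hc : ‖c‖ = 1)
    (hG : iwasawaToPowerSeries p G = PowerSeries.C ((p : ℚ_[p]) ^ m * c) * iwasawaToPowerSeries p L) :
    ∃ c' : ℤ_[p], (c' : ℚ_[p]) = c ∧ IsUnit c' ∧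
      G = PowerSeries.C ((p : ℤ_[p]) ^ m) * (PowerSeries.C c' * L) := by
  set c' : ℤ_[p] := ⟨c, hc.le⟩ with hc'
  refine ⟨c', rfl, PadicInt.isUnit_iff.mpr hc, ?_⟩
  apply iwasawaToPowerSeries_injective p
  have h1 : iwasawaToPowerSeries p (PowerSeries.C c') = PowerSeries.C c := by
    rw [iwasawaToPowerSeries, PowerSeries.map_C]; rfl
  rw [hG, map_mul (iwasawaToPowerSeries p), map_mul (iwasawaToPowerSeries p), iwasawaToPowerSeries_C_natCast_pow, h1,
    ← mul_assoc, ← map_mul]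

end Period

section PeriodTwo

/-- **Pointwise: unit period ratios + (V2♭) ⟹ (GV2Λ).** For Pollack pairs of `f, f_A` at `2`, period ratios `ϖ, ϖ_A` of
`2`-adic norm `1`, integral multiples `ι G = 2^m ϖ ι L♭`, `ι G_A = 2^{m'} ϖ_A ι L♭_A` and `E, E_A ∈ Λ`: a congruence
`L♭ E − u₀ L♭_A E_A ∈ 2Λ` of the `Ω⁺`-normalised functions gives `2^{m'} G E − u 2^m G_A E_A ∈ 2^{m+m'+1}Λ` with the unit
`u = ϖ̃ u₀ ϖ̃_A⁻¹`. [cite: GreenbergVatsal2000, §3, (13) and Remark (3.4)] -/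
theorem lambda_congruence_two_of_flat_congruence {Lplus Lminus LplusA LminusA : IwasawaAlgebra 2}
    {ϖ ϖA : ℚ} (hϖ1 : ‖(ϖ : ℚ_[2])‖ = 1) (hϖA1 : ‖(ϖA : ℚ_[2])‖ = 1) {G GA E EA : IwasawaAlgebra 2} {m m' : ℕ}
    (hG : iwasawaToPowerSeries 2 G =
      PowerSeries.C ((2 : ℚ_[2]) ^ m * (ϖ : ℚ_[2])) * iwasawaToPowerSeries 2 (kobayashiL 1 Lplus Lminus))
    (hGA : iwasawaToPowerSeries 2 GA =
      PowerSeries.C ((2 : ℚ_[2]) ^ m' * (ϖA : ℚ_[2])) * iwasawaToPowerSeries 2 (kobayashiL 1 LplusA LminusA))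
    {u₀ : ℤ_[2]ˣ} {q : IwasawaAlgebra 2}
    (hflat : kobayashiL 1 Lplus Lminus * E - PowerSeries.C (u₀ : ℤ_[2]) * kobayashiL 1 LplusA LminusA * EA =
      PowerSeries.C (2 : ℤ_[2]) * q) :
    ∃ (u : ℤ_[2]ˣ) (q₀ : IwasawaAlgebra 2),
      PowerSeries.C ((2 : ℤ_[2]) ^ m') * G * E - PowerSeries.C ((u : ℤ_[2]) * (2 : ℤ_[2]) ^ m) * GA * EA =
        PowerSeries.C ((2 : ℤ_[2]) ^ (m + m' + 1)) * q₀ := by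
  set L := kobayashiL 1 Lplus Lminus with hL
  set LA := kobayashiL 1 LplusA LminusA with hLA
  -- the two unit scalars: `G = 2^m (c L)`, `G_A = 2^{m'} (c_A L_A)`
  have hG' : iwasawaToPowerSeries 2 G =
      PowerSeries.C (((2 : ℕ) : ℚ_[2]) ^ m * (ϖ : ℚ_[2])) * iwasawaToPowerSeries 2 L := by
    rw [Nat.cast_ofNat]; exact hG
  have hGA' : iwasawaToPowerSeries 2 GA =
      PowerSeries.C (((2 : ℕ) : ℚ_[2]) ^ m' * (ϖA : ℚ_[2])) * iwasawaToPowerSeries 2 LA := by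
    rw [Nat.cast_ofNat]; exact hGA
  obtain ⟨c, -, hcu, hGeq⟩ := exists_eq_C_pow_mul_C_mul_of_norm_eq_one (p := 2) hϖ1 hG'
  obtain ⟨cA, -, hcAu, hGAeq⟩ := exists_eq_C_pow_mul_C_mul_of_norm_eq_one (p := 2) hϖA1 hGA'
  rw [Nat.cast_ofNat] at hGeq hGAeq
  -- the unit `u = c u₀ cA⁻¹`
  set U : ℤ_[2]ˣ := hcu.unit * u₀ * hcAu.unit⁻¹ with hU
  refine ⟨U, PowerSeries.C c * q, ?_⟩
  have hinvA : ((hcAu.unit⁻¹ : ℤ_[2]ˣ) : ℤ_[2]) * cA = 1 := hcAu.unit.inv_mul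
  have hinv : (U : ℤ_[2]) * cA = c * (u₀ : ℤ_[2]) := by
    rw [hU, Units.val_mul, Units.val_mul, IsUnit.unit_spec, mul_assoc, hinvA, mul_one]
  have hUcA : PowerSeries.C (U : ℤ_[2]) * PowerSeries.C cA =
      (PowerSeries.C c * PowerSeries.C (u₀ : ℤ_[2]) : IwasawaAlgebra 2) := by
    rw [← map_mul, ← map_mul, hinv]
  have e1 : (PowerSeries.C ((U : ℤ_[2]) * (2 : ℤ_[2]) ^ m) : IwasawaAlgebra 2) =
      PowerSeries.C (U : ℤ_[2]) * PowerSeries.C ((2 : ℤ_[2]) ^ m) := map_mul _ _ _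
  have e2 : (PowerSeries.C ((2 : ℤ_[2]) ^ (m + m' + 1)) : IwasawaAlgebra 2) =
      PowerSeries.C ((2 : ℤ_[2]) ^ m) * PowerSeries.C ((2 : ℤ_[2]) ^ m') * PowerSeries.C (2 : ℤ_[2]) := by
    rw [pow_succ, pow_add, map_mul, map_mul]
  rw [hGeq, hGAeq, e1, e2]
  linear_combination (PowerSeries.C ((2 : ℤ_[2]) ^ m) * PowerSeries.C ((2 : ℤ_[2]) ^ m') * PowerSeries.C c) * hflat -
    (PowerSeries.C ((2 : ℤ_[2]) ^ m) * PowerSeries.C ((2 : ℤ_[2]) ^ m') * LA * EA) * hUcA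

/-- **Pointwise converse: unit period ratios + (GV2Λ for all integral multiples) ⟹ (V2♭).** Testing the `Λ`-congruence on
the unit multiples `G = ϖ̃ L♭`, `G_A = ϖ̃_A L♭_A` (`m = m' = 0`) returns the `Ω⁺`-normalised congruence
`L♭ E − u' L♭_A E_A ∈ 2Λ` with `u' = ϖ̃⁻¹ u ϖ̃_A`. [cite: GreenbergVatsal2000, §3, (13) and Remark (3.4)] -/
theorem flat_congruence_two_of_lambda_congruence {Lplus Lminus LplusA LminusA : IwasawaAlgebra 2}
    {ϖ ϖA : ℚ} (hϖ1 : ‖(ϖ : ℚ_[2])‖ = 1) (hϖA1 : ‖(ϖA : ℚ_[2])‖ = 1) {E EA : IwasawaAlgebra 2}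
    (hΛ : ∀ (G : IwasawaAlgebra 2) (m : ℕ), iwasawaToPowerSeries 2 G =
          PowerSeries.C ((2 : ℚ_[2]) ^ m * (ϖ : ℚ_[2])) * iwasawaToPowerSeries 2 (kobayashiL 1 Lplus Lminus) →
      ∀ (GA : IwasawaAlgebra 2) (m' : ℕ), iwasawaToPowerSeries 2 GA =
          PowerSeries.C ((2 : ℚ_[2]) ^ m' * (ϖA : ℚ_[2])) * iwasawaToPowerSeries 2 (kobayashiL 1 LplusA LminusA) →
      ∃ (u : ℤ_[2]ˣ) (q₀ : IwasawaAlgebra 2),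
        PowerSeries.C ((2 : ℤ_[2]) ^ m') * G * E - PowerSeries.C ((u : ℤ_[2]) * (2 : ℤ_[2]) ^ m) * GA * EA =
          PowerSeries.C ((2 : ℤ_[2]) ^ (m + m' + 1)) * q₀) :
    ∃ (u : ℤ_[2]ˣ) (q : IwasawaAlgebra 2),
      kobayashiL 1 Lplus Lminus * E - PowerSeries.C (u : ℤ_[2]) * kobayashiL 1 LplusA LminusA * EA =
        PowerSeries.C (2 : ℤ_[2]) * q := by
  set L := kobayashiL 1 Lplus Lminus with hL
  set LA := kobayashiL 1 LplusA LminusA with hLA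
  set c : ℤ_[2] := ⟨(ϖ : ℚ_[2]), hϖ1.le⟩ with hc
  set cA : ℤ_[2] := ⟨(ϖA : ℚ_[2]), hϖA1.le⟩ with hcA
  have hcu : IsUnit c := PadicInt.isUnit_iff.mpr hϖ1
  have hcAu : IsUnit cA := PadicInt.isUnit_iff.mpr hϖA1
  -- the unit multiples at `m = m' = 0`
  have hιc : iwasawaToPowerSeries 2 (PowerSeries.C c) = PowerSeries.C (ϖ : ℚ_[2]) := by
    rw [iwasawaToPowerSeries, PowerSeries.map_C]; rfl
  have hιcA : iwasawaToPowerSeries 2 (PowerSeries.C cA) = PowerSeries.C (ϖA : ℚ_[2]) := by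
    rw [iwasawaToPowerSeries, PowerSeries.map_C]; rfl
  have hG : iwasawaToPowerSeries 2 (PowerSeries.C c * L) =
      PowerSeries.C ((2 : ℚ_[2]) ^ 0 * (ϖ : ℚ_[2])) * iwasawaToPowerSeries 2 L := by
    rw [map_mul, hιc, pow_zero, one_mul]
  have hGA : iwasawaToPowerSeries 2 (PowerSeries.C cA * LA) =
      PowerSeries.C ((2 : ℚ_[2]) ^ 0 * (ϖA : ℚ_[2])) * iwasawaToPowerSeries 2 LA := by
    rw [map_mul, hιcA, pow_zero, one_mul]
  obtain ⟨u, q₀, H⟩ := hΛ _ 0 hG _ 0 hGA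
  simp only [pow_zero, mul_one, zero_add, pow_one, map_one, one_mul] at H
  -- invert the unit `c`
  obtain ⟨cinv, hcinv⟩ : ∃ x : ℤ_[2], x = ((hcu.unit⁻¹ : ℤ_[2]ˣ) : ℤ_[2]) := ⟨_, rfl⟩
  have hcc : cinv * c = 1 := by rw [hcinv]; exact hcu.unit.inv_mul
  have e : PowerSeries.C cinv * PowerSeries.C c = (1 : IwasawaAlgebra 2) := by rw [← map_mul, hcc, map_one]
  refine ⟨hcu.unit⁻¹ * u * hcAu.unit, PowerSeries.C cinv * q₀, ?_⟩
  have hu' : ((hcu.unit⁻¹ * u * hcAu.unit : ℤ_[2]ˣ) : ℤ_[2]) = cinv * (u : ℤ_[2]) * cA := by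
    rw [hcinv, Units.val_mul, Units.val_mul, IsUnit.unit_spec]
  have e2 : (PowerSeries.C ((hcu.unit⁻¹ * u * hcAu.unit : ℤ_[2]ˣ) : ℤ_[2]) : IwasawaAlgebra 2) =
      PowerSeries.C cinv * PowerSeries.C (u : ℤ_[2]) * PowerSeries.C cA := by
    rw [hu', map_mul, map_mul]
  linear_combination (PowerSeries.C cinv) * H - (L * E) * e - (LA * EA) * e2

end PeriodTwo

end Summit.BirchSwinnertonDyer.BirchSwinnertonDyer.Theorems.MazurTateCongruenceAtTwoR

end
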